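import Mathlib.Topology.Algebra.OpenSubgroup
import Mathlib.Topology.MetricSpace.Ultra.TotallySeparated
import Mathlib.NumberTheory.Padics.ProperSpace
import Literature.AnabelianGeometry.AbsoluteAnabelian.AbsTopII.EllipticAdmissible
import Literature.AnabelianGeometry.AbsoluteAnabelian.AbsTopII.EllipticAdmissibleNonVacuity
import Literature.AnabelianGeometry.AbsoluteAnabelian.FreeProcyclicModel
import HarnessLib

/-!
# [AbsTopII] Def 3.1: what EVERY elliptic-admissibility witness forces — the finite-`Δ` obstruction

S. Mochizuki, *Topics in Absolute Anabelian Geometry II: Decomposition Groups and Endomorphisms*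
[AbsTopII], Definition 3.1 p. 65 (manuscript pagination, lit key `paper:url-585b8d0ad0d9`; bib key
`MochizukiAbsTopII2013`).  PROOF-ONLY companion (no definitions) of `AbsTopII/EllipticAdmissible.lean`
(abc-iut-L4-t6, p404980), which types Def 3.1 — "`X` is `Π`-elliptically admissible" — as the DATA
record `EllipticAdmissibilityWitness M X Q` over the isogeny-level MODEL INTERFACE `IsogenyModel`
(shape (M), no instance in the tree): (a) a `k`-core `X → C`; (b) `C` semi-elliptic, doubly covered
by a once-punctured elliptic curve `D → C`; (c) a hyperbolic curve `Y → X` arising from a normal open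
`Π_Y ⊆ Π` with `Y → C` factoring through `D → C`, and the pro-`Σ` clause "for every set of primes `Σ`
such that some open subgroup of `Δ` is pro-`Σ`, it holds that `Δ` is pro-`Σ`, and, moreover, the
degree of the covering `Y → C ×_k k_Y` is a product of primes `∈ Σ`".

abc-iut cell, §4(iii) NON-VACUITY census (INHABITATION-CENSUS-L4 v1–v5, HOME/staging/w5/w5-d197/): the
row `EllipticAdmissibilityWitness` is WITNESSED by abc-iut-w4-d071's 2-adic isogeny-level model
(`AbsTopII/EllipticAdmissibleNonVacuity.lean`, p439176: `Π = Δ = ℤ₂`, the double covering `D → C`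
realised by `x ↦ 2x`).  This file is the complementary STRUCTURAL half — theorems about OUR record at
EVERY model — explaining why no finite toy could have inhabited it and which `Δ` can:

* `two_dvd_relIndex_comp_of_index_two` (pure index calculus in extensions `1 → Δ → Π → G → 1`) and
  `EllipticAdmissibilityWitness.two_dvd_relIndex`: the index `[Π_C ×_{G_k} G_{k_Y} : Π_Y]` of clause
  (c) is EVEN (or infinite) — `Y → C` factors through the degree-`2` covering `D → C` over `k` of clause
  (b), so that index is a multiple of `[Π_C ×_{G_k} G_{k_Y} : Π_D ∩ (Π_C ×_{G_k} G_{k_Y})]`, which is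
  `≤ [Π_C : Π_D] = 2` and `≠ 1` because `Δ_C ⊆ Π_C ×_{G_k} G_{k_Y}` while `Π_D·Δ_C = Π_C ≠ Π_D`.
* `EllipticAdmissibilityWitness.two_mem`: hence a witness forces `2 ∈ Σ` for EVERY `Σ` such that some
  open subgroup of `Δ = Δ_Π` is pro-`Σ`; so `Δ` is pro-`Σ` for no `Σ ∌ 2` (`not_isProSigmaGroup_geom`),
  there is NO witness at any data with FINITE `Δ` (`isEmpty_of_finite_geom`: the trivial subgroup is
  then open and pro-`∅`), and none at data with `Δ ≅ ℤ_l`, `l` an ODD prime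
  (`isEmpty_of_geom_equiv_padicInt`) — whereas `Δ ≅ ℤ₂` is inhabited (w4-d071).  The typed Def 3.1 is
  thus a CONTINGENT condition on the data (`isEllipticallyAdmissible_contingent`), and its clause (c)
  REQUIRES an infinite `Δ` in which `2` divides the index of some open subgroup of every open subgroup —
  as for the intended model (`Δ` a profinite surface group).
* Tools BY NAME: `IsProSigmaGroup.of_continuousMulEquiv` / `isProSigmaGroup_congr` /
  `IsProSigmaGroup.subgroup_map` / `IsProSigmaGroup.of_subsingleton` (the predicate of Def 3.1 (c) is
  invariant under isomorphisms of topological groups; trivial groups are pro-`Σ` for all `Σ`);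
  `isProSigmaGroup_padicInt_iff` (`ℤ_l` is pro-`Σ` iff `l ∈ Σ`, from the tree's
  `isFreeProSigmaCyclic_singleton_padicInt`).

HONEST FRAMING: theorems about OUR typing of Def 3.1 (the record `EllipticAdmissibilityWitness`) at
arbitrary isogeny-level models, plus classical facts about `ℤ_l`; nothing here is a statement about
hyperbolic orbicurves or about print.  Witnessed ≠ discharged; typed ≠ proved; nothing here bears on,
or takes a side on, [IUTchIII] Cor 3.12.
-/
noncomputable section

open CategoryTheory Topology

namespace Literature.AnabelianGeometry.AbsoluteAnabelian.AbsTopII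

open Literature.AnabelianGeometry.Anabelioids (IsSigmaInteger)
open FundamentalExtension

universe u v

/-! ### The pro-`Σ` predicate of Def 3.1 (c): transport and trivial cases -/

section Transport

variable {G : Type u} {H : Type v} [Group G] [TopologicalSpace G] [Group H] [TopologicalSpace H]

/-- `IsProSigmaGroup Σ` ("pro-`Σ`": every open normal subgroup of finite index has `Σ`-integer index,
[AbsTopII] Def 3.1 (c) p. 65) is invariant under isomorphisms of topological groups: pull an open
normal finite-index subgroup back along the isomorphism (same index).
[cite: MochizukiAbsTopII2013, Def 3.1 (c) p.65] -/
theorem IsProSigmaGroup.of_continuousMulEquiv {S : Set ℕ} (e : G ≃ₜ* H) (h : IsProSigmaGroup S G) :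
    IsProSigmaGroup S H := by
  refine ⟨fun N hN hNo hNf => ?_⟩
  have hidx : (N.comap (e.toMulEquiv : G →* H)).index = N.index :=
    N.index_comap_of_surjective e.toMulEquiv.surjective
  have hopen : IsOpen ((N.comap (e.toMulEquiv : G →* H) : Subgroup G) : Set G) := by
    rw [Subgroup.coe_comap]
    exact hNo.preimage e.continuous
  haveI : (N.comap (e.toMulEquiv : G →* H)).FiniteIndex := by
    refine ⟨?_⟩
    rw [hidx]
    haveI := hNf
    exact Subgroup.FiniteIndex.index_ne_zero
  have hint := h.index_isSigmaInteger (N.comap (e.toMulEquiv : G →* H)) (hN.comap _) hopen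
    inferInstance
  rwa [hidx] at hint

/-- `IsProSigmaGroup Σ` is decided by the isomorphism class of the topological group.
[cite: MochizukiAbsTopII2013, Def 3.1 (c) p.65] -/
theorem isProSigmaGroup_congr {S : Set ℕ} (e : G ≃ₜ* H) :
    IsProSigmaGroup S G ↔ IsProSigmaGroup S H :=
  ⟨fun h => h.of_continuousMulEquiv e, fun h => h.of_continuousMulEquiv e.symm⟩

/-- Transport of "the (open) subgroup `K` is pro-`Σ`" along an isomorphism of topological groups
`e : G ≃ H`: the subgroup `e(K)` of `H` is pro-`Σ` (the restriction `K ≃ e(K)` is an isomorphism of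
topological groups for the subspace topologies). [cite: MochizukiAbsTopII2013, Def 3.1 (c) p.65] -/
theorem IsProSigmaGroup.subgroup_map {S : Set ℕ} (e : G ≃ₜ* H) (K : Subgroup G)
    (hK : IsProSigmaGroup S K) : IsProSigmaGroup S (K.map (e.toMulEquiv : G →* H)) := by
  let f : K ≃ₜ* K.map (e.toMulEquiv : G →* H) :=
    { e.toMulEquiv.subgroupMap K with
      continuous_toFun := by
        apply continuous_induced_rng.2
        show Continuous fun x : K => (e x : H)
        exact e.continuous.comp continuous_subtype_val
      continuous_invFun := by
        apply continuous_induced_rng.2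
        show Continuous fun y : K.map (e.toMulEquiv : G →* H) => (e.symm y : G)
        exact e.symm.continuous.comp continuous_subtype_val }
  exact hK.of_continuousMulEquiv f

omit [TopologicalSpace G] in
/-- The trivial group is pro-`Σ` for EVERY `Σ` (all its subgroups have index `1`, a `Σ`-integer with
no prime factor) — the reason the hypothesis of Def 3.1 (c) is never void at data with discrete `Δ`.
[cite: MochizukiAbsTopII2013, Def 3.1 (c) p.65] -/
theorem IsProSigmaGroup.of_subsingleton [TopologicalSpace G] [Subsingleton G] (S : Set ℕ) :
    IsProSigmaGroup S G := by
  refine ⟨fun N _ _ _ => ?_⟩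
  have hN : N = ⊤ := eq_top_iff.2 fun x _ => by
    rw [Subsingleton.elim x 1]
    exact N.one_mem
  rw [hN, Subgroup.index_top]
  exact ⟨Nat.one_pos, fun p hp hp1 => absurd (Nat.le_of_dvd Nat.one_pos hp1) (not_le.2 hp.one_lt)⟩

end Transport

/-! ### `ℤ_l` is pro-`Σ` iff `l ∈ Σ` -/

section PadicInt

/-- `ℤ_l` (multiplicatively) is pro-`Σ` if and only if `l ∈ Σ`: its open subgroups have exactly the
powers of `l` as indices (the tree's `isFreeProSigmaCyclic_singleton_padicInt`), and it has one of
index `l`. [cite: RibesZalesskii2010, Thm 2.7.1] -/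
theorem isProSigmaGroup_padicInt_iff (l : ℕ) [hl : Fact l.Prime] {S : Set ℕ} :
    IsProSigmaGroup S (Multiplicative ℤ_[l]) ↔ l ∈ S := by
  have hZ := isFreeProSigmaCyclic_singleton_padicInt l
  constructor
  · intro h
    obtain ⟨K, hKo, hKi⟩ := (hZ.isOpen_index_iff l).2
      ⟨hl.out.pos, fun p hp hpl => Set.mem_singleton_iff.2 ((Nat.prime_dvd_prime_iff_eq hp hl.out).1 hpl)⟩
    haveI : K.FiniteIndex := ⟨by rw [hKi]; exact hl.out.ne_zero⟩
    have hint := h.index_isSigmaInteger K (Subgroup.normal_of_isMulCommutative K) hKo inferInstance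
    rw [hKi] at hint
    exact hint.2 l hl.out dvd_rfl
  · intro hlS
    refine ⟨fun N _ hNo _ => ?_⟩
    have hN : IsSigmaInteger {l} N.index := (hZ.isOpen_index_iff N.index).1 ⟨N, hNo, rfl⟩
    refine ⟨hN.1, fun p hp hpN => ?_⟩
    rw [Set.mem_singleton_iff.1 (hN.2 p hp hpN)]
    exact hlS

end PadicInt

/-! ### What every witness forces: the index of Def 3.1 (c) is even -/

section Negative

/-- **Index calculus behind Def 3.1 (b)+(c).**  In extensions `1 → Δ → Π → G → 1`: if `φ : E_D → E_C`
is surjective on Galois groups (e.g. "over `k`") with `[Π_C : φ(Π_D)] = 2`, then for every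
`f = g ≫ φ : E_Y → E_C` factoring through `φ`, the index of `f(Π_Y)` in
`Π_C ×_{G_C} f(G_Y) := aug⁻¹(f(G_Y))` is EVEN (or infinite, index `0`): that index is a multiple of
`[Π_C ×_{G_C} f(G_Y) : φ(Π_D) ∩ (Π_C ×_{G_C} f(G_Y))]`, which is `≤ [Π_C : φ(Π_D)] = 2` and `≠ 1`
because `Δ_C ⊆ Π_C ×_{G_C} f(G_Y)` while `φ(Π_D)·Δ_C = Π_C ≠ φ(Π_D)`.
[cite: MochizukiAbsTopII2013, Def 3.1 p.65] -/
theorem two_dvd_relIndex_comp_of_index_two {EY ED EC : FundamentalExtension.{u}} (g : EY ⟶ ED)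
    (φ : ED ⟶ EC) (hφ : Function.Surjective φ.gal)
    (h2 : (φ.arith.toMonoidHom.range).index = 2) :
    2 ∣ ((g ≫ φ).arith.toMonoidHom.range).relIndex
      (((g ≫ φ).gal.toMonoidHom.range).comap EC.aug.toMonoidHom) := by
  -- Step A: `f(Π_Y) ≤ aug⁻¹(f(G_Y))`
  have hHK : (g ≫ φ).arith.toMonoidHom.range ≤
      ((g ≫ φ).gal.toMonoidHom.range).comap EC.aug.toMonoidHom := by
    rintro _ ⟨x, rfl⟩
    exact ⟨EY.aug x, ((g ≫ φ).comm x).symm⟩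
  -- Step B: `f(Π_Y) ≤ φ(Π_D)`
  have hHR : (g ≫ φ).arith.toMonoidHom.range ≤ φ.arith.toMonoidHom.range := by
    rintro _ ⟨x, rfl⟩
    exact ⟨g.arith x, rfl⟩
  -- Step C: `Δ_C ≤ aug⁻¹(f(G_Y))`
  have hΔK : EC.geom ≤ ((g ≫ φ).gal.toMonoidHom.range).comap EC.aug.toMonoidHom := by
    intro x hx
    change EC.aug x ∈ (g ≫ φ).gal.toMonoidHom.range
    rw [(FundamentalExtension.mem_geom EC).1 hx]
    exact one_mem _
  -- Step D: `φ(Π_D) ⊔ Δ_C = ⊤`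
  have hRΔ : φ.arith.toMonoidHom.range ⊔ EC.geom = ⊤ := by
    rw [eq_top_iff]
    intro x _
    obtain ⟨γ, hγ⟩ := hφ (EC.aug x)
    obtain ⟨d, hd⟩ := ED.aug_surjective γ
    have hmem : (φ.arith d)⁻¹ * x ∈ EC.geom := by
      rw [FundamentalExtension.mem_geom, map_mul, map_inv, φ.comm d, hd, hγ, inv_mul_cancel]
    have hdR : φ.arith d ∈ φ.arith.toMonoidHom.range := ⟨d, rfl⟩
    have h := Subgroup.mul_mem_sup hdR hmem
    rwa [mul_inv_cancel_left] at h
  -- Step E: `aug⁻¹(f(G_Y)) ≰ φ(Π_D)`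
  have hKR : ¬ ((g ≫ φ).gal.toMonoidHom.range).comap EC.aug.toMonoidHom ≤
      φ.arith.toMonoidHom.range := by
    intro hle
    have htop : φ.arith.toMonoidHom.range = ⊤ := by
      rw [← hRΔ]
      exact (sup_eq_left.2 (hΔK.trans hle)).symm
    have h1 : (φ.arith.toMonoidHom.range).index = 1 := by rw [htop]; exact Subgroup.index_top
    omega
  -- Step F–G: `[aug⁻¹(f(G_Y)) : φ(Π_D) ∩ aug⁻¹(f(G_Y))] ∈ {0, 2}`
  have hle : (φ.arith.toMonoidHom.range).relIndex
      (((g ≫ φ).gal.toMonoidHom.range).comap EC.aug.toMonoidHom) ≤ 2 := by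
    have h2' : (φ.arith.toMonoidHom.range).relIndex ⊤ = 2 := by
      rw [Subgroup.relIndex_top_right]; exact h2
    have h := Subgroup.relIndex_le_of_le_right (H := φ.arith.toMonoidHom.range)
      (le_top : ((g ≫ φ).gal.toMonoidHom.range).comap EC.aug.toMonoidHom ≤ ⊤) (by rw [h2']; decide)
    rwa [h2'] at h
  have hne1 : (φ.arith.toMonoidHom.range).relIndex
      (((g ≫ φ).gal.toMonoidHom.range).comap EC.aug.toMonoidHom) ≠ 1 :=
    fun h => hKR (Subgroup.relIndex_eq_one.1 h)
  -- Step H: it divides the index in question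
  have hdvd : (φ.arith.toMonoidHom.range).relIndex
      (((g ≫ φ).gal.toMonoidHom.range).comap EC.aug.toMonoidHom) ∣
      ((g ≫ φ).arith.toMonoidHom.range).relIndex
        (((g ≫ φ).gal.toMonoidHom.range).comap EC.aug.toMonoidHom) := by
    have h := Subgroup.relIndex_mul_relIndex ((g ≫ φ).arith.toMonoidHom.range)
      (φ.arith.toMonoidHom.range ⊓ ((g ≫ φ).gal.toMonoidHom.range).comap EC.aug.toMonoidHom)
      (((g ≫ φ).gal.toMonoidHom.range).comap EC.aug.toMonoidHom) (le_inf hHR hHK) inf_le_right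
    rw [Subgroup.inf_relIndex_right] at h
    exact Dvd.intro_left _ h
  -- conclude: the divisor is `0` (then so is the index) or `2`
  rcases Nat.eq_zero_or_pos ((φ.arith.toMonoidHom.range).relIndex
      (((g ≫ φ).gal.toMonoidHom.range).comap EC.aug.toMonoidHom)) with h0 | hpos
  · rw [h0, zero_dvd_iff] at hdvd
    rw [hdvd]
    exact dvd_zero 2
  · have h2eq : (φ.arith.toMonoidHom.range).relIndex
        (((g ≫ φ).gal.toMonoidHom.range).comap EC.aug.toMonoidHom) = 2 := by omega
    rwa [h2eq] at hdvd

variable {M : IsogenyModel.{u}} {X : M.Curve} {Q : ArithmeticQuotient (M.ext X)}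

/-- **At every model, for every witness of Def 3.1: the degree of `Y → C ×_k k_Y` is even** (as an
index; `0` if infinite) — the double covering `D → C` of clause (b) sits inside the covering `Y → C`
of clause (c). [cite: MochizukiAbsTopII2013, Def 3.1 p.65] -/
theorem EllipticAdmissibilityWitness.two_dvd_relIndex (W : EllipticAdmissibilityWitness M X Q) :
    2 ∣ (((M.extMap W.covMap ≫ M.extMap W.toCore).arith.toMonoidHom.range).relIndex
      (((M.extMap W.covMap ≫ M.extMap W.toCore).gal.toMonoidHom.range).comap
        (M.ext W.core).aug.toMonoidHom)) := by
  rw [W.fac]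
  exact two_dvd_relIndex_comp_of_index_two (M.extMap W.covToEll) (M.extMap W.ellToCore)
    W.ellToCore_isOver.2 W.degree_ellToCore

/-- Hence, whenever that degree is a `Σ`-integer (clause (c), last part), `2 ∈ Σ`.
[cite: MochizukiAbsTopII2013, Def 3.1 (c) p.65] -/
theorem EllipticAdmissibilityWitness.two_mem_of_isSigmaInteger (W : EllipticAdmissibilityWitness M X Q)
    {S : Set ℕ}
    (h : IsSigmaInteger S
      (((M.extMap W.covMap ≫ M.extMap W.toCore).arith.toMonoidHom.range).relIndex
        (((M.extMap W.covMap ≫ M.extMap W.toCore).gal.toMonoidHom.range).comap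
          (M.ext W.core).aug.toMonoidHom))) :
    2 ∈ S :=
  h.2 2 Nat.prime_two W.two_dvd_relIndex

/-- **What every elliptic-admissibility witness forces** (OUR typing of [AbsTopII] Def 3.1, at every
isogeny-level model): for every set of primes `Σ` such that SOME OPEN SUBGROUP of `Δ = Δ_Π` is
pro-`Σ`, one has `2 ∈ Σ` — clause (c) makes the (even) degree of `Y → C ×_k k_Y` a `Σ`-integer.
[cite: MochizukiAbsTopII2013, Def 3.1 (c) p.65] -/
theorem EllipticAdmissibilityWitness.two_mem (W : EllipticAdmissibilityWitness M X Q) {S : Set ℕ}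
    (hS : ∃ H : Subgroup Q.ext.geom, IsOpen (H : Set Q.ext.geom) ∧ IsProSigmaGroup S H) :
    2 ∈ S :=
  W.two_mem_of_isSigmaInteger (W.proSigma S hS).2

/-- Consequently `Δ = Δ_Π` is pro-`Σ` for NO set of primes `Σ` not containing `2` (take the open
subgroup `Δ` itself). [cite: MochizukiAbsTopII2013, Def 3.1 (c) p.65] -/
theorem EllipticAdmissibilityWitness.not_isProSigmaGroup_geom (W : EllipticAdmissibilityWitness M X Q)
    {S : Set ℕ} (h2 : 2 ∉ S) : ¬ IsProSigmaGroup S Q.ext.geom := by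
  intro hΔ
  -- `Δ ≃ ⊤ ≤ Δ` as topological groups
  let e : ↥Q.ext.geom ≃ₜ* ↥(⊤ : Subgroup Q.ext.geom) :=
    { (Subgroup.topEquiv : (⊤ : Subgroup Q.ext.geom) ≃* Q.ext.geom).symm with
      continuous_toFun := by
        show Continuous fun x : Q.ext.geom => (⟨x, Subgroup.mem_top x⟩ : ↥(⊤ : Subgroup Q.ext.geom))
        exact continuous_id.subtype_mk _
      continuous_invFun := by
        show Continuous fun x : ↥(⊤ : Subgroup Q.ext.geom) => (x : Q.ext.geom)
        exact continuous_subtype_val }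
  refine h2 (W.two_mem ⟨⊤, ?_, hΔ.of_continuousMulEquiv e⟩)
  rw [Subgroup.coe_top]
  exact isOpen_univ

/-- **No witness at data with finite `Δ`.**  If `Δ = Δ_Π` is finite (e.g. all groups of the data are
finite — every "toy" of that kind), then `EllipticAdmissibilityWitness M X Q` is EMPTY: `Δ` is then
discrete, its trivial subgroup is open and pro-`∅`, and `2 ∈ ∅` is absurd.  So the typed clause (c)
of [AbsTopII] Def 3.1 REQUIRES an infinite `Δ`. [cite: MochizukiAbsTopII2013, Def 3.1 (c) p.65] -/
theorem EllipticAdmissibilityWitness.isEmpty_of_finite_geom [Finite Q.ext.geom] :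
    IsEmpty (EllipticAdmissibilityWitness M X Q) := by
  refine ⟨fun W => ?_⟩
  haveI : Subsingleton ↥(⊥ : Subgroup Q.ext.geom) :=
    ⟨fun a b => Subtype.ext ((Subgroup.mem_bot.mp a.2).trans (Subgroup.mem_bot.mp b.2).symm)⟩
  have h := W.two_mem (S := (∅ : Set ℕ)) ⟨⊥, isOpen_discrete _, IsProSigmaGroup.of_subsingleton _⟩
  exact (Set.mem_empty_iff_false 2).1 h

/-- Restatement: "`X` is `Π`-elliptically admissible" (as typed) FAILS whenever `Δ ⊆ Π` is finite.
[cite: MochizukiAbsTopII2013, Def 3.1 p.65] -/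
theorem not_isEllipticallyAdmissibleWith_of_finite_geom [Finite Q.ext.geom] :
    ¬ IsEllipticallyAdmissibleWith M X Q := fun ⟨W⟩ =>
  (EllipticAdmissibilityWitness.isEmpty_of_finite_geom (Q := Q)).false W

end Negative

/-! ### Which `Δ` can carry a witness: `ℤ_l` for odd `l` cannot, `ℤ₂` can (w4-d071) -/

section Contingent

variable {M : IsogenyModel.{u}} {X : M.Curve} {Q : ArithmeticQuotient (M.ext X)}

/-- **No witness at data with `Δ ≅ ℤ_l`, `l` an odd prime**: `Δ` is then pro-`{l}` with `2 ∉ {l}`.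
(Contrast: at `Δ ≅ ℤ₂` the record IS inhabited — abc-iut-w4-d071's 2-adic model
`exists_isEllipticallyAdmissible_model`.) [cite: MochizukiAbsTopII2013, Def 3.1 (c) p.65] -/
theorem EllipticAdmissibilityWitness.isEmpty_of_geom_equiv_padicInt (l : ℕ) [Fact l.Prime]
    (hl : l ≠ 2) (e : Q.ext.geom ≃ₜ* Multiplicative ℤ_[l]) :
    IsEmpty (EllipticAdmissibilityWitness M X Q) :=
  ⟨fun W => W.not_isProSigmaGroup_geom (S := ({l} : Set ℕ))
    (fun h => hl (Set.mem_singleton_iff.1 h).symm)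
    (((isProSigmaGroup_padicInt_iff l).2 (Set.mem_singleton l)).of_continuousMulEquiv e.symm)⟩

/-- **The typed Def 3.1 is a CONTINGENT condition on the data** (neither vacuous nor void):
satisfiable — abc-iut-w4-d071's 2-adic isogeny-level model (`exists_isEllipticallyAdmissible_model`,
`AbsTopII/EllipticAdmissibleNonVacuity.lean`) — and unsatisfiable at any data with finite `Δ`, e.g. the
one-curve model on the trivial extension `1 → 1` (`not_isEllipticallyAdmissibleWith_of_finite_geom`).
[cite: MochizukiAbsTopII2013, Def 3.1 p.65] -/
theorem isEllipticallyAdmissible_contingent :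
    (∃ (M : IsogenyModel.{0}) (X : M.Curve), IsEllipticallyAdmissible M X) ∧
      ∃ (M : IsogenyModel.{0}) (X : M.Curve), ¬ IsEllipticallyAdmissible M X := by
  refine ⟨?_, ?_⟩
  · obtain ⟨M, X, -, hX, -⟩ := exists_isEllipticallyAdmissible_model
    exact ⟨M, X, hX⟩
  -- the trivial extension `1 → 1` (one curve, identity morphism): `Δ` is finite
  let E : FundamentalExtension.{0} :=
    ⟨ProfiniteGrp.of PUnit.{1}, ProfiniteGrp.of PUnit.{1}, 1, fun _ => ⟨1, Subsingleton.elim _ _⟩⟩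
  let M : IsogenyModel.{0} :=
    { Curve := PUnit
      ext := fun _ => E
      FinEt := fun _ _ => PUnit
      extMap := fun _ => 𝟙 E
      extMap_isOpenInjective := fun _ => Hom.IsOpenInjective.id E
      IsScheme := fun _ => True
      genus := fun _ => 1
      cuspCard := fun _ => 1
      IsDefinedOverNF := fun _ => True }
  haveI : Finite ↥(ArithmeticQuotient.self (M.ext PUnit.unit)).ext.geom :=
    inferInstanceAs (Finite ↥E.geom)
  exact ⟨M, PUnit.unit, not_isEllipticallyAdmissibleWith_of_finite_geom⟩

end Contingent

end Literature.AnabelianGeometry.AbsoluteAnabelian.AbsTopII
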